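import Literature.MathematicalPhysics.QuantumFieldTheory.Balaban1983to89.Node00.CarriersFrame
import Literature.MathematicalPhysics.QuantumFieldTheory.Balaban1983to89.Node00.NonVacuityTheta
import Literature.MathematicalPhysics.QuantumFieldTheory.Balaban1983to89.Node00.Satisfiable
import Literature.MathematicalPhysics.QuantumFieldTheory.Balaban1983to89.B4ThmAlphaUniform

/-!
# NODE N01 · [Balaban1983RegularityDecay] — DISCHARGE DOSSIER at the NODE 00 worlds of record (Stage 1, carried to Stage 2):
# the node BY NAME, its four printed legs IN KERNEL FORM at the objects of record, non-vacuity, and «what this is not»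

TRACK A (YM-PLAN §2, node N01 of 28), seat `pub-ymgap-dag-p3` (prover; payload OPS-REQUESTS l.312 § dag-p3; house rules R415).
THEOREMS ONLY, def-free, sorry-free, standard axioms.  The CONVENTIONS OF RECORD block of the root module `Node00Carriers` applies.
EVERYTHING MATHEMATICAL BELOW IS AN EXISTING KERNEL THEOREM OF THE TREE, USED BY NAME; this file is the referee-facing ASSEMBLY
(YM-PLAN §1 (a)(b)(c): the referee reads the landed file against the printed page and the node's in-edges) — it re-proves nothing
of Bałaban's and moves no count by itself (the count move is the leads' act after the referee's read, species rule R414 (B)(v) +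
director-ym №5).

## THE NODE.  `Dag.B4_main ℓ := ℓ.b4` (`…Balaban1983to89.Dag`, :178) — N01 is the SOURCE node of the Yang–Mills chain: NO in-edge
(`N01_iff_leaf_b4`), so the vacuity guard of YM-PLAN §1 is met trivially (no in-edge leaf is consumed or refuted).  Venue statement of
record `YMDAG.N01 w P := Dag.B4_main (DagBinding.leavesP w P)` (`HOME/lean/ym-dag/N01_B4.lean`) — DEFINITIONALLY the type proved
here; the re-pointed venue slot `N01_holds (w) (hw : Node00.IsWorldOfRecord₁ w) (P)` has body `Node00.b4_main_of_isWorldOfRecord₁ w hw P`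
(staged bytes c41b2c7bc9fae881; farm rc 0 · 0 sorry · std axioms, 2026-08-25).  At a world of record the leaf `b4` is read at the
N-BINDING `DagBinding.Upstream.ofPrintedAllXPN` (referee ruling G-ref1-32 = R325 D3 = Q-N00-7): `b4 = DagDischargedII.B4LeafNN famE famU
famF d N := ThmPrintedNN famE ∧ Prop23Printed famU ∧ Prop31Printed famF ∧ Sect5ThmUniform d N`.

## BOTH-LEGS TABLE (conjunct ↔ typed decl (file) ↔ printed statement (CMP **89** (1983), journal page = PDF page + 570) ↔ family OF RECORD
## it is instantiated at (`CarriersFrame.carriers₁_groupB4`, `rfl`) ↔ the lineage theorem that proves it there, BY NAME) — kernel form: `N01_iff_legs`.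
| # | typed conjunct | print | family of record at `θ : Stage1Params` | proved by |
|---|---|---|---|---|
| 1 | `B4Ineq111ZeroNestEta.ThmPrintedNN famE` (`∀ α, 0 ≤ α → α < 1 → ∃ δ₀ c₀ R₀ e₁ > 0, ∀ i, regular → bigBlocks → 0 < e ≤ e₁ → (1.9)–(1.10) ∧ (1.11)–(1.12)`; = `B4.ThmPrinted` (B4.lean :146) with the ONE binder `0 ≤ α` added) | Theorem p. 573 «(Proposition 2.1 of [1]). For α<1 there exist positive constants δ₀, c₀, R₀ independent of A, k, Ω and depending on d, M only, c₀ on α also, such that for e sufficiently small and for an arbitrary function f : Ω → R^N, we have (1.9) … (1.10) … (1.11) … with the additional factor (1.12) … For … rectangular parallelepipeds, the inequalities hold without any restrictions on the points x, x′» | `famE := B4TorusPairFam.torusPairFam θ.F (D−1) (L−1) a₋ a₊ m²₊ c β (Kmod …)` — torus region pairs `Ω ⊂ Ω₀ ⊂ T_η` at a (1.7)-regular field `A`, big-block size `Kmod` | `B4ThmTorusPairEta.thmPrintedNN_torusPairFam` (lit-balaban r01) — `N01_leg_thm573NN` |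
| 2 | `B4.Prop23Printed famU` (B4.lean :350: `∃ δ₀ c₀ γ₀ γ₁ e₁ > 0, ∀ i, … → (1.15) ∧ (1.16) ∧ (1.18) ∧ (1.20)`) | «Proposition 2.3 of [1]» p. 574, (1.13)–(1.20) | `famU := B4Prop23RegularWindow.regularFieldRegionsW θ.F (L−1+1) a₋ a₊ a′ c β m²₊` — nested finite unions of `L`-blocks in `ℤ^{(D−1)+1}`, every `Λ`, `a_k ∈ [a₋, a₊]` | `B4Prop23RegularWindow.prop23Printed_regularWindow` (lit-balaban p17) — `N01_leg_prop23` |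
| 3 | `B4.Prop31Printed famF` (B4.lean :387: `∃ γ₀ e₁ > 0, ∀ α > 0, ∃ O(1) ≥ 0, ∀ i, unitBlocks → reg121 → 0 < e ≤ e₁ → ∀ φ, (1.22)`) | «Proposition 3.1′ of [2]» p. 574, (1.21)–(1.22) | `famF := B4Prop31Regular.regularFormSetting θ.F a m² O(1) a₀ p` — every finite union of unit blocks, (1.21)-regular `A` | `B4Prop31Regular.prop31Printed_regularRegion` (lit-balaban p35) — `N01_leg_prop31` |
| 4 | `B4.Sect5ThmUniform d N` (B4.lean :524, the UNIFORM reading; implies the literal one `Sect5ThmLiteral`, :534) | Sect. 5 Theorem p. 594, (5.6)–(5.10) (+ p. 597 «The constants δ₁, c₁ are functions of δ₀, γ₀, c₀») | `(d, N) := (θ.d₅, θ.N₅)` — a closed statement, holds for EVERY `(d, N)` | `B4Sect5Proof.sect5ThmUniform_holds` (pub-balaban pv23) — `N01_leg_sect5`, `N01_leg_sect5_literal` |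

## LOCATED CAVEATS (verbatim species words; READINGS adjudicated by the cross-read and the leads, cited — not re-litigated here)
* conjunct 1, Hölder range: typed `0 ≤ α < 1` (G-ref1-32, R325 D3).  The LITERAL typed leaf `B4.ThmPrinted` («∀ α < 1», hence α < 0 too) is
  REFUTED AS TYPED at zero field on b04's box family (`B4Thm19ZeroBoxNegAlpha.not_thmPrinted_boxFamB`, binding level
  `DagDischargedII.not_ofPrintedAllXP_withBoxFamE_b4`; packaged `B4RuledReadings.ruling_thm573_boxFam`) — §4 below records it AT WORLD LEVEL for
  the node statement: `not_N01_at_XP_boxFamB`.  The N-binding is therefore the binding of record; this dossier discharges N01 THERE and nowhere else.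
* famE, cross-read XREAD-B4 v0.5 916ee200b5ee85da (ym3ir-theory-1) §2–§4: 17 leaf-read fields — 15 match ∕ convention, 1 stronger in letter
  (`lhs19`: `sup` over admissible contours ⊇ print's shortest contour; derivable, and B4 is PROVED here), 1 WEAKER than print allows (`rect`: the
  `R₀`-waiver «for rectangular parallelepipeds … without any restrictions» is typed on the FULL TORUS only; sub-boxes keep the `R₀` restriction),
  0 diverges.  RULED R325 D2 (leads' joint sitting 2026-08-24T20:00Z): «N01 [B4] famE∕famU∕famF of record, `rect` + F-torusU ADMIT-AS-TYPED (torus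
  consumers only in the DAG; named periodisation lemma owed iff a sub-box consumer is typed) ⇒ n∕28 at its Stage-1 event».
* famU (XREAD §6): 11 fields — 7 match ∕ convention ∕ exact, 4 stronger (certified), 0 weaker; scope flag F-torusU (regions in `ηℤ^{d+1}`, not torus
  regions — print's primary setting p. 572; ADMIT, R325 D2).  famF (XREAD §7): 8∕8 match, 0 weaker; consumer flag F-windowF (count-neutral): `(a_k, m²)`
  are FAMILY parameters, so conjunct 3 is certified PER VALUE, print's «γ₀ depending on d only» is uniform (p. 590's formula is monotone in `a_k`).
  F-M: the big-block size of record is the definite `Kmod …` (print: «M a large positive integer defined later in this paper»).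
* typed-vs-printed residue already booked by the b04 ∕ r01 lineages: D-b04.2 ((1.12)'s doubled distance read as one distance per argument, from the
  proof p. 579 and Cor. 2.3 p. 581), D-b04.4 (L-dependence of Prop. 2.3's constants), Prop. 2.3 proved by the printed §5 route.
* SPECIES (R414 (B)(v) + director-ym №5): typed ≥ printed in every leaf-read clause EXCEPT `rect` (weaker, ADMITTED by R325 D2 with its consumer
  condition) — nothing here is flagged anew; the referee and the leads own the words.
* ADDENDUM 2026-08-25 (seat gen 4; the two discharge-referee reads of the day, pub-ymgap INBOX l.8917 ref-D ∕ l.8922–8924 ref-C, PASS with ONE further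
  located reading: p. 573 «δ₀, c₀, R₀ … depending on d, M only, c₀ on α also» makes δ₀, R₀ α-UNIFORM, conjunct 1's typed `∀ α ∃ δ₀ c₀ R₀ e₁` does not):
  the print's quantifier order HOLDS at the famE of record — `B4ThmAlphaUniform.thmPrintedNNUnif_torusPairFam` (p409452 ce3e7fc06eb8; `ThmPrintedNNUnif
  famE := ∃ δ₀ R₀ > 0, ∀ α ∈ [0,1), ∃ c₀ e₁ > 0, ∀ i, …`, δ₀ = (4K)⁻¹, R₀ = K(d+4)+2 as in r01's proof), recorded in §5 as `N01_leg_thm573NN_unif`;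
  the smallness threshold e₁ stays after α, as p. 573 prints it («such that for e sufficiently small»).  Conjunct 1 itself is unchanged (implied
  by the uniform form, `B4ThmAlphaUniform.thmPrintedNN_of_unif`); count-neutral.

## WHAT THIS IS ∕ IS NOT.  IS: the kernel reading of [Balaban1983RegularityDecay]'s four series-DAG statements AT THE NODE 00 OBJECTS OF RECORD
(Stage 1: `Node00.carriers₁ θ X`, admissible `θ`; p385856 d006336fedf2, p393613 e0c4e5317ee3), stable under the Stage-2 pin (p394343 a0c530480bab) and
the one-level B6 side pin, with the families inhabited and every antecedent met below every threshold (§3).  IS NOT: a proof of the literal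
«∀ α < 1» leaf (false as typed, §4); a statement about the P-binding `ofPrintedAllXP`; anything about nodes N02–N28, the construction `w.C`
(Stage 5), the continuum limit, ℝ⁴, infinite volume, OS axioms, a mass gap or the Clay problem.  One finite four-torus programme at fixed ε
([Balaban1989LargeFieldII] Thm 1 scope); a world of record with physical dimension `D = 4` exists (§3).

REVISIONS.  v1.1 (seat gen 4, 2026-08-25): APPEND-ONLY — one import (`B4ThmAlphaUniform`), §5 `N01_leg_thm573NN_unif` ∕ `N01_famE_thm573NN_unif`,
the ADDENDUM bullet above;
every v1.0 declaration (p403313 eb75ae0f131d) byte-identical.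
-/

noncomputable section

namespace Literature.MathematicalPhysics.QuantumFieldTheory.Balaban1983to89.Node00

open scoped Matrix
open DagBinding DagDischargedII B4GaugeCovariance
open B4 (Prop23Printed Prop31Printed Sect5ThmUniform Sect5ThmLiteral)
open B4Ineq111ZeroNestEta (ThmPrintedNN)
open B4ThmRegionPairEta (Kmod)
open B4TorusPairFam (torusPairFam)
open B4ThmTorusPairEta (thmPrintedNN_torusPairFam)
open B4Prop23RegularWindow (regularFieldRegionsW prop23Printed_regularWindow)
open B4Prop31Regular (regularFormSetting prop31Printed_regularRegion)
open B4Sect5Proof (sect5ThmUniform_holds)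

/-! ## §0. The node statement is the leaf `b4` itself (source node: no in-edge to consume) -/

/-- **N01 has no in-edge**: `Dag.B4_main ℓ` IS the leaf `ℓ.b4` (`Iff.rfl`) — the vacuity guard of YM-PLAN §1 is met trivially (nothing is
derived from an in-edge leaf). [cite: Balaban1983RegularityDecay, Theorem p.573 and Sect. 5 Theorem p.594 (the node's content; bookkeeping)] -/
theorem N01_iff_leaf_b4 (ℓ : Dag.Leaves) : Dag.B4_main ℓ ↔ ℓ.b4 :=
  Iff.rfl

/-! ## §1. THE NODE AT THE WORLDS OF RECORD, BY NAME -/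

/-- **N01 · [Balaban1983RegularityDecay] AT EVERY NODE 00 WORLD OF RECORD (Stage 1), EVERY RUN** — the payload's `N01_at_record`:
`∀ w, IsWorldOfRecord₁ w → ∀ P, Dag.B4_main (leavesP w P)` (venue: `YMDAG.N01 w P`), the root's `b4_main_of_isWorldOfRecord₁` BY NAME
(p393613 e0c4e5317ee3).  Hypotheses: the world-of-record predicate only (no in-edge; no named fact). [cite: Balaban1983RegularityDecay, Theorem (1.9)–(1.12) p.573 (0 ≤ α form), Prop. 2.3 of [1] (1.15)–(1.20) p.574, Prop. 3.1′ of [2] (1.21)–(1.22) p.574, Sect. 5 Theorem (5.6)–(5.10) p.594 — kernel versions of the lit-balaban lineages at the objects of record] -/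
theorem N01_at_record : ∀ w : WorldP, IsWorldOfRecord₁ w → ∀ P : B12.RunParams, Dag.B4_main (leavesP w P) :=
  fun w hw P => b4_main_of_isWorldOfRecord₁ w hw P

/-- **N01 at every world of record, Stage 2** (the [Balaban1985Averaging] group pinned as well; `IsWorldOfRecord₂ → IsWorldOfRecord₁`,
`Node00Carriers2`, p394343 a0c530480bab) — the discharge is STABLE under the later pin. [cite: Balaban1983RegularityDecay, Theorem p.573, Props. 2.3 / 3.1′ p.574, Sect. 5 Theorem p.594 — kernel versions at the objects of record, Stage 2] -/
theorem N01_at_record₂ : ∀ w : WorldP, IsWorldOfRecord₂ w → ∀ P : B12.RunParams, Dag.B4_main (leavesP w P) :=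
  fun w hw P => b4_main_of_isWorldOfRecord₂ w hw P

/-- **N01 at every world of the ONE-LEVEL B6 side reading** (`IsWorldOfRecord₁OL → IsWorldOfRecord₁`, root §5) — stable under that side
pin too. [cite: Balaban1983RegularityDecay, Theorem p.573, Props. 2.3 / 3.1′ p.574, Sect. 5 Theorem p.594 — kernel versions at the objects of record] -/
theorem N01_at_record₁OL : ∀ w : WorldP, IsWorldOfRecord₁OL w → ∀ P : B12.RunParams, Dag.B4_main (leavesP w P) :=
  fun w hw P => b4_main_of_isWorldOfRecord₁ w (isWorldOfRecord₁_of_isWorldOfRecord₁OL w hw) P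

/-! ## §2. BOTH LEGS IN KERNEL FORM: the node at a run of a world of record UNFOLDS to the four printed statements at the
## families of record, and each leg is the lineage's theorem BY NAME -/

section Legs

variable (θ : Stage1Params)

/-- **Leg 1 — Theorem p. 573 (= Prop. 2.1 of (Higgs)₂,₃ I) in its `0 ≤ α < 1` form, AT THE η-FAMILY OF RECORD** (torus region pairs
`Ω ⊂ Ω₀ ⊂ T_η` at a (1.7)-regular field, `θ`'s flow, lattice `ℤ^{(D−1)+1}`, block `L − 1 + 1 = L`, windows `[a₋, a₊]`, `m²₊`, constants `(c, β)`,
big blocks `Kmod`): `B4ThmTorusPairEta.thmPrintedNN_torusPairFam` by name (consumes `c ≥ 0`, `β > 0` of `θ.Admissible`). [cite: Balaban1983RegularityDecay, Theorem (Proposition 2.1 of [1]) (1.9)–(1.12) p.573] -/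
theorem N01_leg_thm573NN (hθ : θ.Admissible) :
    ThmPrintedNN (torusPairFam θ.F (θ.D - 1) (θ.L - 1) θ.amin θ.aplus θ.m2plus θ.creg θ.β
      (Kmod θ.F θ.hℓ₁ θ.hLip (θ.D - 1) (θ.L - 1) θ.one_le_pred θ.amin θ.aplus θ.m2plus θ.ha)) := by
  obtain ⟨_, _, hcreg, hβ, _⟩ := hθ
  exact thmPrintedNN_torusPairFam θ.F θ.hℓ₁ θ.hLip (θ.D - 1) (θ.L - 1) θ.one_le_pred θ.amin θ.aplus θ.m2plus θ.ha
    θ.creg θ.β hcreg hβ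

/-- **Leg 2 — «Proposition 2.3 of [1]» (1.15)–(1.20) AT THE UNIT-LATTICE FAMILY OF RECORD** (nested finite unions of `L`-blocks in
`ℤ^{(D−1)+1}`, every `Λ`, `a_k ∈ [a₋, a₊]`, coefficient `a′`): `B4Prop23RegularWindow.prop23Printed_regularWindow` by name (consumes `a₋ ≤ a₊`,
`c ≥ 0`, `β > 0`, `a′ > 0`). [cite: Balaban1983RegularityDecay, Proposition 2.3 of [1] (1.15)–(1.20) p.574] -/
theorem N01_leg_prop23 (hθ : θ.Admissible) :
    Prop23Printed (regularFieldRegionsW (d := θ.D - 1) θ.F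
      (Nat.succ_le_succ (Nat.zero_le (θ.L - 1)) : 1 ≤ θ.L - 1 + 1) θ.amin θ.aplus θ.a' θ.creg θ.β θ.m2plus) := by
  obtain ⟨_, hap, hcreg, hβ, ha', _⟩ := hθ
  exact prop23Printed_regularWindow θ.F θ.hℓ₁ θ.hLip _ θ.ha hap ha' hcreg hβ θ.m2plus

/-- **Leg 3 — «Proposition 3.1′ of [2]» (1.21)–(1.22) AT THE FORM FAMILY OF RECORD** (every finite union of unit blocks, (1.21)-regular `A`,
constants `(a, m², O(1), a₀, p)`): `B4Prop31Regular.prop31Printed_regularRegion` by name (consumes `a > 0`, `m² ≥ 0`, `O(1) ≥ 0`, `a₀ ≥ 0`,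
`p > 0`). [cite: Balaban1983RegularityDecay, Proposition 3.1′ of [2] (1.21)–(1.22) p.574] -/
theorem N01_leg_prop31 (hθ : θ.Admissible) :
    Prop31Printed (regularFormSetting (d := θ.D - 1) θ.F θ.a θ.m2 θ.C θ.a₀ θ.p) := by
  obtain ⟨_, _, _, _, _, ha0, hm, hC, ha₀, hp, _⟩ := hθ
  exact prop31Printed_regularRegion θ.F θ.hℓ₁ θ.hLip ha0 hm hC ha₀ hp

/-- **Leg 4 — the Sect. 5 Theorem (5.6)–(5.10) in its UNIFORM reading, at the `(d, N)` of record** — holds for EVERY `(d, N)`: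
`B4Sect5Proof.sect5ThmUniform_holds` by name (no hypothesis). [cite: Balaban1983RegularityDecay, Sect. 5 Theorem (5.6)–(5.10) p.594 and p.597] -/
theorem N01_leg_sect5 : Sect5ThmUniform θ.d₅ θ.N₅ :=
  sect5ThmUniform_holds θ.d₅ θ.N₅

/-- Leg 4 in the LITERAL printed quantifier reading as well (`B4.sect5_literal_of_uniform`). [cite: Balaban1983RegularityDecay, Sect. 5 Theorem (5.6)–(5.10) p.594 (literal reading)] -/
theorem N01_leg_sect5_literal : Sect5ThmLiteral θ.d₅ θ.N₅ :=
  B4.sect5_literal_of_uniform (N01_leg_sect5 θ)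

variable (X : PrintedCarriersR) (Y : PrintedCarriers9X) (Z : PrintedCarriers11) (V : PrintedCarriers14R) (W : PrintedCarriers15)
  (w : WorldP) (P : B12.RunParams)

/-- **THE BOTH-LEGS TABLE, KERNEL FORM.**  At a run `P` of a world whose upstream block is the N-binding over the Stage-1 bundle of record
`carriers₁ θ X`, the node statement `Dag.B4_main (leavesP w P)` (venue `YMDAG.N01 w P`) IS — `Iff`, by unfolding only — the conjunction of the
four PRINTED statements at the four FAMILIES OF RECORD of the table: Theorem p. 573 (NN form) at `torusPairFam …θ…` ∧ Prop. 2.3 at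
`regularFieldRegionsW …θ…` ∧ Prop. 3.1′ at `regularFormSetting …θ…` ∧ the Sect. 5 Theorem at `(θ.d₅, θ.N₅)`.  Nothing hides behind the binding.
[cite: Balaban1983RegularityDecay, Theorem (1.9)–(1.12) p.573, Prop. 2.3 of [1] (1.15)–(1.20) p.574, Prop. 3.1′ of [2] (1.21)–(1.22) p.574, Sect. 5 Theorem p.594 (dictionary: what the node asserts at the objects of record)] -/
theorem N01_iff_legs (hP : w.up P = Upstream.ofPrintedAllXPN (carriers₁ θ X) Y Z V W) :
    Dag.B4_main (leavesP w P) ↔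
      ThmPrintedNN (torusPairFam θ.F (θ.D - 1) (θ.L - 1) θ.amin θ.aplus θ.m2plus θ.creg θ.β
          (Kmod θ.F θ.hℓ₁ θ.hLip (θ.D - 1) (θ.L - 1) θ.one_le_pred θ.amin θ.aplus θ.m2plus θ.ha)) ∧
      Prop23Printed (regularFieldRegionsW (d := θ.D - 1) θ.F
          (Nat.succ_le_succ (Nat.zero_le (θ.L - 1)) : 1 ≤ θ.L - 1 + 1) θ.amin θ.aplus θ.a' θ.creg θ.β θ.m2plus) ∧
      Prop31Printed (regularFormSetting (d := θ.D - 1) θ.F θ.a θ.m2 θ.C θ.a₀ θ.p) ∧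
      Sect5ThmUniform θ.d₅ θ.N₅ := by
  rw [b4_main_iff_of_up hP, (leaves_carriers₁_pinned θ X Y Z V W).1]
  exact Iff.rfl

/-- **The node at the run FROM THE FOUR LEGS** (intro form of `N01_iff_legs`): a proof of N01 at a world of record consumes exactly the four
printed statements at the families of record — no in-edge, no named fact, no placeholder. [cite: Balaban1983RegularityDecay, Theorem p.573, Props. 2.3 / 3.1′ p.574, Sect. 5 Theorem p.594 (assembly; bookkeeping)] -/
theorem N01_of_legs (hP : w.up P = Upstream.ofPrintedAllXPN (carriers₁ θ X) Y Z V W)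
    (h₁ : ThmPrintedNN (torusPairFam θ.F (θ.D - 1) (θ.L - 1) θ.amin θ.aplus θ.m2plus θ.creg θ.β
      (Kmod θ.F θ.hℓ₁ θ.hLip (θ.D - 1) (θ.L - 1) θ.one_le_pred θ.amin θ.aplus θ.m2plus θ.ha)))
    (h₂ : Prop23Printed (regularFieldRegionsW (d := θ.D - 1) θ.F
      (Nat.succ_le_succ (Nat.zero_le (θ.L - 1)) : 1 ≤ θ.L - 1 + 1) θ.amin θ.aplus θ.a' θ.creg θ.β θ.m2plus))
    (h₃ : Prop31Printed (regularFormSetting (d := θ.D - 1) θ.F θ.a θ.m2 θ.C θ.a₀ θ.p))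
    (h₄ : Sect5ThmUniform θ.d₅ θ.N₅) : Dag.B4_main (leavesP w P) :=
  (N01_iff_legs θ X Y Z V W w P hP).2 ⟨h₁, h₂, h₃, h₄⟩

/-- **The node at the run, assembled LEG BY LEG from the four lineage theorems** (a second proof of `b4_main_of_isWorldOfRecord₁`'s content at
the run, routed through the table rather than through `B4LeafRegular.leafNN_torusPairFam`). [cite: Balaban1983RegularityDecay, Theorem p.573, Props. 2.3 / 3.1′ p.574, Sect. 5 Theorem p.594 — kernel versions of the lit-balaban lineages, assembled] -/
theorem N01_at_run (hθ : θ.Admissible) (hP : w.up P = Upstream.ofPrintedAllXPN (carriers₁ θ X) Y Z V W) :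
    Dag.B4_main (leavesP w P) :=
  N01_of_legs θ X Y Z V W w P hP (N01_leg_thm573NN θ hθ) (N01_leg_prop23 θ hθ) (N01_leg_prop31 θ hθ) (N01_leg_sect5 θ)

/-- **The table at Stage 2**: over the Stage-2 bundle `carriers₂ θ X = carriers₁ θ.toStage1Params (withB7OfRecord X …)` the node unfolds to the
SAME four printed statements at the SAME B4 families of record (the B7 pin does not touch the B4 group). [cite: Balaban1983RegularityDecay, Theorem p.573, Props. 2.3 / 3.1′ p.574, Sect. 5 Theorem p.594 (dictionary, Stage 2)] -/
theorem N01_iff_legs₂ (θ₂ : Stage2Params) (hP : w.up P = Upstream.ofPrintedAllXPN (carriers₂ θ₂ X) Y Z V W) :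
    Dag.B4_main (leavesP w P) ↔
      ThmPrintedNN (torusPairFam θ₂.F (θ₂.D - 1) (θ₂.L - 1) θ₂.amin θ₂.aplus θ₂.m2plus θ₂.creg θ₂.β
          (Kmod θ₂.F θ₂.hℓ₁ θ₂.hLip (θ₂.D - 1) (θ₂.L - 1) θ₂.toStage1Params.one_le_pred θ₂.amin θ₂.aplus
            θ₂.m2plus θ₂.ha)) ∧
      Prop23Printed (regularFieldRegionsW (d := θ₂.D - 1) θ₂.F
          (Nat.succ_le_succ (Nat.zero_le (θ₂.L - 1)) : 1 ≤ θ₂.L - 1 + 1) θ₂.amin θ₂.aplus θ₂.a' θ₂.creg θ₂.β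
          θ₂.m2plus) ∧
      Prop31Printed (regularFormSetting (d := θ₂.D - 1) θ₂.F θ₂.a θ₂.m2 θ₂.C θ₂.a₀ θ₂.p) ∧
      Sect5ThmUniform θ₂.d₅ θ₂.N₅ :=
  N01_iff_legs θ₂.toStage1Params (withB7OfRecord X θ₂.D θ₂.L θ₂.𝔸) Y Z V W w P hP

end Legs

/-! ## §3. NON-VACUITY, BY NAME: worlds of record exist (with `D = 4`), the families are inhabited, the antecedents are met -/

/-- **There IS a world of record, and the node holds at it**: `∃ w, IsWorldOfRecord₁ w ∧ ∀ P, Dag.B4_main (leavesP w P)` (the root's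
`Stage1Params.exists_admissible` + `Node00Satisfiable.exists_isWorldOfRecord₁`) — the universally quantified discharge `N01_at_record` is not
about an empty class of worlds. [cite: Balaban1983RegularityDecay, (1.1)–(1.7) pp.572–573 (objects of record; bookkeeping)] -/
theorem N01_worldOfRecord_exists : ∃ w : WorldP, IsWorldOfRecord₁ w ∧ ∀ P : B12.RunParams, Dag.B4_main (leavesP w P) := by
  obtain ⟨w, _, _, _, _, hw⟩ := exists_isWorldOfRecord₁
  exact ⟨w, hw, fun P => b4_main_of_isWorldOfRecord₁ w hw P⟩

/-- **… in the physical dimension**: a world of record whose family parameters have `D = 4` (B4's lattice `ℤ^{(D−1)+1} = ℤ⁴`; the one finite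
FOUR-torus programme), with the node at every run. [cite: Balaban1983RegularityDecay, (1.1)–(1.7) pp.572–573 (objects of record, D = 4 witness; bookkeeping)] -/
theorem N01_worldOfRecord_exists_dim4 :
    ∃ (w : WorldP) (θ : Stage1Params), θ.Admissible ∧ θ.D = 4 ∧
      (∀ P : B12.RunParams, ∃ (X : PrintedCarriersR) (Y : PrintedCarriers9X) (Z : PrintedCarriers11) (V : PrintedCarriers14R)
        (W : PrintedCarriers15), w.up P = Upstream.ofPrintedAllXPN (carriers₁ θ X) Y Z V W) ∧
      ∀ P : B12.RunParams, Dag.B4_main (leavesP w P) := by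
  obtain ⟨w, θ, hθ, hD, hup, hw⟩ := exists_isWorldOfRecord₁
  exact ⟨w, θ, hθ, hD, hup, fun P => b4_main_of_isWorldOfRecord₁ w hw P⟩

/-- **At every world of record and every run, the node holds ON NON-DEGENERATE FAMILIES**: the upstream block is the N-binding over some
`carriers₁ θ X` (admissible `θ`) whose three B4 index types (and the B5 index) are INHABITED and whose three B4 families have members meeting
their conjunct's printed antecedents («A regular», «Ω a union of big blocks», «e sufficiently small»: `0 < e ≤ e₁`) below EVERY threshold `e₁ > 0`
(`Node00NonVacuityTheta.isWorldOfRecord₁_nonvacuous`, from the r01 lineage's `leafNN_torusPairFam_nonvacuous`) — so none of the four legs is an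
implication with unsatisfiable hypotheses (vacuity standard Q-N00-6). [cite: Balaban1983RegularityDecay, Theorem p.573, Prop. 2.3 of [1] p.574, Prop. 3.1′ of [2] p.574 («for e sufficiently small»; bookkeeping over the lineage's non-vacuity lemmas)] -/
theorem N01_at_record_nonvacuous (w : WorldP) (hw : IsWorldOfRecord₁ w) (P : B12.RunParams) :
    Dag.B4_main (leavesP w P) ∧
    ∃ (θ : Stage1Params) (X : PrintedCarriersR) (Y : PrintedCarriers9X) (Z : PrintedCarriers11) (V : PrintedCarriers14R)
      (W : PrintedCarriers15), θ.Admissible ∧ w.up P = Upstream.ofPrintedAllXPN (carriers₁ θ X) Y Z V W ∧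
      (Nonempty (carriers₁ θ X).I4E ∧ Nonempty (carriers₁ θ X).I4U ∧ Nonempty (carriers₁ θ X).I4F ∧ Nonempty (carriers₁ θ X).I5) ∧
      ∀ e₁ : ℝ, 0 < e₁ →
        (∃ i : (carriers₁ θ X).I4E, ((carriers₁ θ X).famE i).regular ∧ ((carriers₁ θ X).famE i).bigBlocks ∧
            0 < ((carriers₁ θ X).famE i).e ∧ ((carriers₁ θ X).famE i).e ≤ e₁) ∧
          (∃ i : (carriers₁ θ X).I4U, ((carriers₁ θ X).famU i).regular ∧ ((carriers₁ θ X).famU i).bigBlocks ∧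
            0 < ((carriers₁ θ X).famU i).e ∧ ((carriers₁ θ X).famU i).e ≤ e₁) ∧
          (∃ i : (carriers₁ θ X).I4F, ((carriers₁ θ X).famF i).unitBlocks ∧ ((carriers₁ θ X).famF i).reg121 ∧
            0 < ((carriers₁ θ X).famF i).e ∧ ((carriers₁ θ X).famF i).e ≤ e₁) :=
  ⟨b4_main_of_isWorldOfRecord₁ w hw P, isWorldOfRecord₁_nonvacuous w hw P⟩

/-! ## §4. WHAT THIS IS NOT: the SAME binding-agnostic node statement is FALSE at a world bound by the LITERAL P-binding over b04's
## zero-field box family — the discharge above is a statement about the N-binding of record (G-ref1-32), not about «∀ α < 1» -/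

/-- **The XP hazard at world level.**  If a world's upstream block at the run is the literal P-binding `Upstream.ofPrintedAllXP` over carriers
whose η-family is b04's verbatim zero-field box family `boxFamB` (`ℓ ≥ 1`, `0 ≤ m²₊`, `a > 0`, `Mb ≥ 1`, any boundary data `g`), then the node
statement `Dag.B4_main (leavesP w P)` is FALSE there: its conjunct 1 is the typed `B4.ThmPrinted` («∀ α < 1»), refuted at α < 0, A = 0
(`DagDischargedII.not_ofPrintedAllXP_withBoxFamE_b4` ← `B4Thm19ZeroBoxNegAlpha`, by name).  Hence no discharge of N01 «as literally typed at XP»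
exists, and none is claimed. [cite: Balaban1983RegularityDecay, Theorem p.573, case A = 0 — kernel refutation of the literal range «α < 1» of the typed transcription `B4.ThmPrinted`; the printed Hölder range is 0 ≤ α < 1] -/
theorem not_N01_at_XP_boxFamB (X : PrintedCarriersR) (Y : PrintedCarriers9X) (Z : PrintedCarriers11) (V : PrintedCarriers14R)
    (W : PrintedCarriers15) {d ℓ : ℕ} {m2plus : ℝ} (hℓ : 1 ≤ ℓ) (hm2 : 0 ≤ m2plus) {a : ℝ} (ha : 0 < a) {Mb : ℕ}
    (hMb : 1 ≤ Mb) (g : ∀ i : B4Cor23ZeroEta.ZeroFieldInstance d, (↥i.R → ℝ) → ℝ) (w : WorldP) (P : B12.RunParams)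
    (hP : w.up P = Upstream.ofPrintedAllXP (X.withBoxFamE d ℓ m2plus a Mb g) Y Z V W) :
    ¬ Dag.B4_main (leavesP w P) := by
  show ¬ (w.up P).b4
  rw [hP]
  exact not_ofPrintedAllXP_withBoxFamE_b4 X Y Z V W hℓ hm2 ha hMb g

/-- **XP ⇒ XPN, never conversely.**  Over the SAME carriers, the node at a world bound by the literal P-binding implies the node at a world
bound by the N-binding (`DagDischargedII.ofPrintedAllXPN_b4_of_ofPrintedAllXP`: the typed leaf implies its `0 ≤ α` restriction) — so the
discharge of record is the WEAKER, faithful reading; §4's first theorem shows the converse direction is not available in general.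
[cite: Balaban1983RegularityDecay, Theorem p.573 (the two typed readings of «For α<1»; bookkeeping)] -/
theorem N01_at_XPN_of_XP (X : PrintedCarriersR) (Y : PrintedCarriers9X) (Z : PrintedCarriers11) (V : PrintedCarriers14R)
    (W : PrintedCarriers15) (w w' : WorldP) (P : B12.RunParams) (hP : w.up P = Upstream.ofPrintedAllXP X Y Z V W)
    (hP' : w'.up P = Upstream.ofPrintedAllXPN X Y Z V W) (h : Dag.B4_main (leavesP w P)) :
    Dag.B4_main (leavesP w' P) := by
  change (w.up P).b4 at h
  show (w'.up P).b4
  rw [hP] at h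
  rw [hP']
  exact ofPrintedAllXPN_b4_of_ofPrintedAllXP X Y Z V W h

/-! ## §5. ADDENDUM (v1.1): leg 1 in the PRINT'S quantifier order — `δ₀, R₀` before `α` — at the η-family of record -/

/-- **Leg 1 in the print's quantifier order AT THE η-FAMILY OF RECORD**: p. 573 «For α < 1 there exist positive constants δ₀, c₀, R₀ independent
of A, k, Ω and depending on d, M only, c₀ on α also, such that for e sufficiently small …» — `δ₀, R₀` chosen BEFORE `α ∈ [0,1)`, `c₀` and the
threshold after: `B4ThmAlphaUniform.ThmPrintedNNUnif` at `torusPairFam …θ… (Kmod …θ…)` (= `(carriers₁ θ X).famE`, `CarriersFrame.carriers₁_groupB4`),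
by `B4ThmAlphaUniform.thmPrintedNNUnif_torusPairFam` BY NAME (consumes `c ≥ 0`, `β > 0` of `θ.Admissible`).  Implies leg 1 (`N01_leg_thm573NN`) by
`B4ThmAlphaUniform.thmPrintedNN_of_unif`. [cite: Balaban1983RegularityDecay, Theorem (Proposition 2.1 of [1]) (1.9)–(1.12) p.573 «depending on d, M only, c₀ on α also»] -/
theorem N01_leg_thm573NN_unif (θ : Stage1Params) (hθ : θ.Admissible) :
    B4ThmAlphaUniform.ThmPrintedNNUnif (torusPairFam θ.F (θ.D - 1) (θ.L - 1) θ.amin θ.aplus θ.m2plus θ.creg θ.β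
      (Kmod θ.F θ.hℓ₁ θ.hLip (θ.D - 1) (θ.L - 1) θ.one_le_pred θ.amin θ.aplus θ.m2plus θ.ha)) := by
  obtain ⟨_, _, hcreg, hβ, _⟩ := hθ
  exact B4ThmAlphaUniform.thmPrintedNNUnif_torusPairFam θ.F θ.hℓ₁ θ.hLip (θ.D - 1) (θ.L - 1) θ.one_le_pred θ.amin θ.aplus
    θ.m2plus θ.ha θ.creg θ.β hcreg hβ

/-- **… and at the B4 group of the Stage-1 bundle of record itself** (`(carriers₁ θ X).famE`, by `carriers₁_groupB4` — definitional). [cite: Balaban1983RegularityDecay, Theorem (1.9)–(1.12) p.573 «depending on d, M only, c₀ on α also» (at the objects of record)] -/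
theorem N01_famE_thm573NN_unif (θ : Stage1Params) (hθ : θ.Admissible) (X : PrintedCarriersR) :
    B4ThmAlphaUniform.ThmPrintedNNUnif (carriers₁ θ X).famE := by
  rw [(carriers₁_groupB4 θ X).1]
  exact N01_leg_thm573NN_unif θ hθ

end Literature.MathematicalPhysics.QuantumFieldTheory.Balaban1983to89.Node00

end
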